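import Literature.Probability.RandomPlanarGeometry.HalfPlaneAutomorphism
import HarnessLib

/-!
# Disc rectangles with explicit uniformizing data; centrally symmetric markings

Topic `Literature/Probability/RandomPlanarGeometry` (conformal rectangles and their cross-ratio
modulus, `ConformalRectangle.lean`, `ConformalRectangleProofs.lean`). This file makes the
uniformizing data `(φ, x)` of `MarkedDomain.IsUniformizing` EXPLICIT for rectangles obtained from
the unit disc, where the tree so far only has the existence theorem
`MarkedDomain.exists_isUniformizing_holds` (Riemann mapping + Carathéodory):

* `JordanDomain.rotUnitDisc θ₀` — the unit disc with boundary loop `t ↦ e^{i(2πt + θ₀)}` (so any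
  counterclockwise quadruple of circle points can be marked with parameters in `[0, 1)`), and the
  **centrally symmetric disc rectangles** `ConformalRectangle.symmDisc θ₀ s` =
  `(𝔻; ζ, uζ, -ζ, -uζ)`, `ζ = e^{iθ₀}`, `u = e^{2πis}`, `0 < s < 1/2`
  (`symmDisc_pt_zero` … `symmDisc_pt_three`).
* `cayleyFun_tan`, `cayleyFun_tan_half` — the boundary correspondence of the Cayley transform
  `C(z) = (z - i)/(z + i)`: `C(tan φ) = -e^{2iφ}`, so the real point `tan (θ/2 - π/2)` goes to
  `e^{iθ}` (`0 < θ < 2π`), increasingly in `θ` (`strictMonoOn_tan_half`).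
* `ConformalRectangle.isUniformizing_of_disc_extension` — for a conformal map `g : 𝔻 → D` with
  a continuous extension `Ψ` to the closed disc (e.g. Carathéodory's,
  `JordanDomain.exists_continuousOn_extension_holds`; or `g = Ψ = id` for `D = 𝔻`), a unit `η`
  and monotone angles `θ_k ∈ (0, 2π)` with `Ψ (η e^{iθ_k}) = D.pt k`, the datum
  `(g ∘ (η ·) ∘ C, (tan (θ_k/2 - π/2))_k)` uniformizes `D`
  (`JordanDomain.tendsto_nhdsWithin_of_extension`), and its cross-ratio is the complex
  cross-ratio of the circle points (`crossRatio_tan_half`, from `cCrossRatio_moebius`).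
* `cCrossRatio_symm` — the cross-ratio of `(w, vw, -w, -vw)`, `‖v‖ = 1`, is `(1 - re v)/2`; hence
  `ConformalRectangle.exists_isUniformizing_of_symm`: a rectangle whose marked points are
  `Ψ w, Ψ (vw), Ψ (-w), Ψ (-vw)` (`w, v` unit, `v ∉ ℝ`) has a uniformizing datum of cross-ratio
  `(1 - re v)/2` — increasing angles if `im v > 0`, decreasing if `im v < 0`.

These serve the proof of Beffara's "shears distort the conformal modulus"
(`Literature.Barriers.CriticalPhenomena.BeffaraShearDistortsModulus_holds` in
`Literature/Barriers/CriticalPhenomena/EmbeddingModulusUniquenessProofs`), where the disc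
rectangles `(𝔻; ζ, uζ, -ζ, -uζ)` and their sheared images replace the printed square witnesses.

## Mathlib

USED: `circleMap`, `injOn_circleMap_of_abs_sub_le'`, `Real.strictMonoOn_tan`,
`Complex.ofReal_tan`, `Complex.tan_eq_sin_div_cos`, `Complex.exp_pi_mul_I`,
`Complex.norm_mul_exp_arg_mul_I` (polar form), `Real.sin_nonneg_of_nonneg_of_le_pi`,
`Real.sin_nonpos_of_nonpos_of_neg_pi_le`. Tree: `cayley`, `cayleyFun`, `rotBall`,
`JordanDomain.tendsto_nhdsWithin_of_extension` (`CaratheodoryHalfPlane`), `cCrossRatio`,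
`cCrossRatio_moebius`, `cCrossRatio_ofReal` (`HalfPlaneAutomorphism`).

## References

* L. V. Ahlfors, *Complex Analysis*, 3rd ed. (1979), Ch. 3 §3.1 (cross-ratio, linear
  transformations of circles), Ch. 6 §1.1 (boundary correspondence).
* Ch. Pommerenke, *Boundary Behaviour of Conformal Maps* (1992), Thm. 2.6 (Carathéodory).
* V. Beffara, *Is critical 2D percolation universal?*, Progr. Probab. 60 (2008), proof of
  Prop. 4, arXiv:0708.3908, p. 6.
-/

open Set Filter Topology Complex Real Metric
open UpperHalfPlane (upperHalfPlaneSet isOpen_upperHalfPlaneSet)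
open scoped ComplexConjugate

noncomputable section

namespace Literature.Probability.RandomPlanarGeometry

namespace JordanDomain

/-- The open **unit disc with its boundary circle parametrised from the phase `θ₀`**,
`t ↦ exp (i (2πt + θ₀))`: the Jordan domain `JordanDomain.unitDisc` up to a rotation of the
boundary parametrisation (same carrier `𝔻`), so that ANY four points of the circle in
counterclockwise order can be marked with parameters in `[0, 1)`. [folklore] -/
def rotUnitDisc (θ₀ : ℝ) : JordanDomain where
  carrier := ball 0 1
  boundary t := circleMap 0 1 (2 * π * t + θ₀)
  isOpen := isOpen_ball
  isBounded := isBounded_ball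
  isConnected := ((convex_ball (0 : ℂ) 1).isPathConnected (by simp)).isConnected
  continuous_boundary := (continuous_circleMap 0 1).comp (by fun_prop)
  periodic_boundary t := by
    simp only
    rw [show 2 * π * (t + 1) + θ₀ = 2 * π * t + θ₀ + 2 * π by ring]
    exact periodic_circleMap 0 1 _
  injOn_boundary := by
    intro s hs t ht h
    have hinj := injOn_circleMap_of_abs_sub_le' (c := 0) (a := θ₀) (b := θ₀ + 2 * π) one_ne_zero
      (by linarith)
    have key : 2 * π * s + θ₀ = 2 * π * t + θ₀ :=
      hinj ⟨by nlinarith [pi_pos, hs.1], by nlinarith [pi_pos, hs.2]⟩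
        ⟨by nlinarith [pi_pos, ht.1], by nlinarith [pi_pos, ht.2]⟩ h
    have : 2 * π * s = 2 * π * t := by linarith
    exact mul_left_cancel₀ (by positivity) this
  range_boundary := by
    have hs : Function.Surjective fun t : ℝ ↦ 2 * π * t + θ₀ := fun y ↦
      ⟨(y - θ₀) / (2 * π), by field_simp; ring⟩
    rw [frontier_ball _ one_ne_zero, show (fun t : ℝ ↦ circleMap 0 1 (2 * π * t + θ₀)) =
      circleMap 0 1 ∘ fun t : ℝ ↦ 2 * π * t + θ₀ from rfl, hs.range_comp, range_circleMap, abs_one]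

/-- The carrier of `rotUnitDisc θ₀` is the open unit disc (by definition). [folklore] -/
@[simp] theorem rotUnitDisc_carrier (θ₀ : ℝ) : (rotUnitDisc θ₀).carrier = ball 0 1 := rfl

/-- The boundary loop of `rotUnitDisc θ₀` is `t ↦ exp (i (2πt + θ₀))`. [folklore] -/
theorem rotUnitDisc_boundary (θ₀ t : ℝ) :
    (rotUnitDisc θ₀).boundary t = exp ((2 * π * t + θ₀ : ℝ) * I) := by
  show circleMap 0 1 (2 * π * t + θ₀) = _
  simp [circleMap]

end JordanDomain

namespace ConformalRectangle

/-- **The centrally symmetric disc rectangles** `(𝔻; ζ, uζ, -ζ, -uζ)` with `ζ = e^{iθ₀}`,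
`u = e^{2πis}`, `0 < s < 1/2` (marks `0, s, 1/2, 1/2 + s` on the loop `t ↦ e^{i(2πt + θ₀)}`):
the images of the rectangles `(𝔻; 1, u, -1, -u)` under the rotations of the disc. [folklore] -/
def symmDisc (θ₀ s : ℝ) (hs : s ∈ Ioo (0 : ℝ) (1 / 2)) : ConformalRectangle where
  toJordanDomain := JordanDomain.rotUnitDisc θ₀
  mark := ![0, s, 1 / 2, 1 / 2 + s]
  strictMono_mark := by
    refine Fin.strictMono_iff_lt_succ.2 fun k ↦ ?_
    fin_cases k <;> simp <;> linarith [hs.1, hs.2]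
  mark_mem k := by
    have h1 := hs.1
    have h2 := hs.2
    fin_cases k
    · simp
    · simpa using ⟨h1.le, by linarith⟩
    · simp only [Fin.reduceFinMk, Matrix.cons_val, mem_Ico]; norm_num
    · simp only [Fin.reduceFinMk, Matrix.cons_val, mem_Ico]; constructor <;> linarith

variable (θ₀ s : ℝ) (hs : s ∈ Ioo (0 : ℝ) (1 / 2))

/-- The carrier of a symmetric disc rectangle is the unit disc. [folklore] -/
@[simp] theorem symmDisc_carrier : (symmDisc θ₀ s hs).carrier = ball 0 1 := rfl

/-- Marked point `0` of `symmDisc θ₀ s`: `e^{iθ₀}`. [folklore] -/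
theorem symmDisc_pt_zero : (symmDisc θ₀ s hs).pt 0 = exp (θ₀ * I) := by
  show circleMap 0 1 (2 * π * (![0, s, 1 / 2, 1 / 2 + s] : Fin 4 → ℝ) 0 + θ₀) = _
  simp [circleMap]

/-- Marked point `1` of `symmDisc θ₀ s`: `e^{2πis} e^{iθ₀}`. [folklore] -/
theorem symmDisc_pt_one : (symmDisc θ₀ s hs).pt 1 = exp ((2 * π * s : ℝ) * I) * exp (θ₀ * I) := by
  show circleMap 0 1 (2 * π * (![0, s, 1 / 2, 1 / 2 + s] : Fin 4 → ℝ) 1 + θ₀) = _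
  simp only [circleMap, Matrix.cons_val_one, Matrix.cons_val_zero, ofReal_one, one_mul, zero_add]
  rw [← Complex.exp_add]
  congr 1
  push_cast
  ring

/-- Marked point `2` of `symmDisc θ₀ s`: `-e^{iθ₀}`. [folklore] -/
theorem symmDisc_pt_two : (symmDisc θ₀ s hs).pt 2 = -exp (θ₀ * I) := by
  show circleMap 0 1 (2 * π * (![0, s, 1 / 2, 1 / 2 + s] : Fin 4 → ℝ) 2 + θ₀) = _
  simp only [circleMap, Matrix.cons_val, ofReal_one, one_mul, zero_add]
  rw [show ((2 * π * (1 / 2) + θ₀ : ℝ) : ℂ) * I = θ₀ * I + π * I by push_cast; ring,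
    Complex.exp_add, exp_pi_mul_I]
  ring

/-- Marked point `3` of `symmDisc θ₀ s`: `-e^{2πis} e^{iθ₀}`. [folklore] -/
theorem symmDisc_pt_three :
    (symmDisc θ₀ s hs).pt 3 = -(exp ((2 * π * s : ℝ) * I) * exp (θ₀ * I)) := by
  show circleMap 0 1 (2 * π * (![0, s, 1 / 2, 1 / 2 + s] : Fin 4 → ℝ) 3 + θ₀) = _
  simp only [circleMap, Matrix.cons_val, ofReal_one, one_mul, zero_add]
  rw [show ((2 * π * (1 / 2 + s) + θ₀ : ℝ) : ℂ) * I = (2 * π * s : ℝ) * I + θ₀ * I + π * I by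
    push_cast; ring, Complex.exp_add, Complex.exp_add, exp_pi_mul_I]
  ring

end ConformalRectangle

/-! ### Real boundary preimages of circle points under the Cayley map -/

/-- **The Cayley transform on the real axis in angular coordinates**: `C(tan φ) = -e^{2iφ}`
(`cos φ ≠ 0`), `C(z) = (z - i)/(z + i)`. Ahlfors (1979), Ch. 3 §3. [folklore] -/
theorem cayleyFun_tan {φ : ℝ} (hφ : Real.cos φ ≠ 0) :
    cayleyFun (Real.tan φ) = -exp (2 * φ * I) := by
  have hc : Complex.cos φ ≠ 0 := by rw [← Complex.ofReal_cos]; exact ofReal_ne_zero.2 hφ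
  have hpy : Complex.sin φ ^ 2 + Complex.cos φ ^ 2 = 1 := Complex.sin_sq_add_cos_sq _
  have he : exp (2 * φ * I) = (Complex.cos φ + Complex.sin φ * I) ^ 2 := by
    rw [show (2 : ℂ) * φ * I = ((2 : ℕ) : ℂ) * (φ * I) by push_cast; ring, Complex.exp_nat_mul,
      Complex.exp_mul_I]
  have hden : ((Real.tan φ : ℝ) : ℂ) + I ≠ 0 := add_I_ne_zero (by simp)
  rw [cayleyFun_apply, div_eq_iff hden, he, Complex.ofReal_tan, Complex.tan_eq_sin_div_cos]
  field_simp
  linear_combination (-Complex.sin φ + I * Complex.cos φ) * hpy +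
    (2 * Complex.sin φ * Complex.cos φ ^ 2 + Complex.sin φ ^ 2 * Complex.cos φ * I + Complex.sin φ ^ 3) * I_sq

/-- The real point `tan (θ/2 - π/2) = -cot (θ/2)` is sent by the Cayley transform to the circle
point `e^{iθ}` (`0 < θ < 2π`): the boundary correspondence `ℝ → ∂𝔻 ∖ {1}` of `C`, increasing in
`θ`. Ahlfors (1979), Ch. 3 §3. [folklore] -/
theorem cayleyFun_tan_half {θ : ℝ} (hθ : θ ∈ Ioo 0 (2 * π)) :
    cayleyFun (Real.tan (θ / 2 - π / 2)) = exp (θ * I) := by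
  have hcos : Real.cos (θ / 2 - π / 2) ≠ 0 := by
    rw [Real.cos_sub_pi_div_two]
    exact (Real.sin_pos_of_pos_of_lt_pi (by linarith [hθ.1]) (by linarith [hθ.2])).ne'
  rw [cayleyFun_tan hcos, show (2 : ℂ) * ((θ / 2 - π / 2 : ℝ) : ℂ) * I = θ * I - π * I by
    push_cast; ring, Complex.exp_sub, exp_pi_mul_I]
  ring

/-- The angular boundary parameters `θ ↦ tan (θ/2 - π/2)` are strictly increasing on `(0, 2π)`. [folklore] -/
theorem strictMonoOn_tan_half : StrictMonoOn (fun θ : ℝ ↦ Real.tan (θ / 2 - π / 2)) (Ioo 0 (2 * π)) := by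
  intro a ha b hb hab
  exact Real.strictMonoOn_tan ⟨by linarith [ha.1], by linarith [ha.2]⟩
    ⟨by linarith [hb.1], by linarith [hb.2]⟩ (by linarith)

/-! ### Explicit uniformizing data from a disc map with a continuous boundary extension -/

namespace ConformalRectangle

/-- **Explicit uniformizing data of a conformal rectangle from the disc.** Let `g : 𝔻 → D` be a
conformal equivalence with a continuous extension `Ψ` to the closed disc, `η` a unit complex
number and `0 < θ₀, θ₁, θ₂, θ₃ < 2π` increasing or decreasing angles such that the marked points
are `D.pt k = Ψ (η e^{iθ_k})`. Then `φ = g ∘ (η ·) ∘ C : ℍₒ → D` (`C` the Cayley transform) with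
the real points `x_k = tan (θ_k/2 - π/2)` is a uniformizing datum of `(D; pt 0, …, pt 3)`: the
boundary value of `φ` at `x_k` is `Ψ (η C(x_k)) = Ψ (η e^{iθ_k})`. (For `D = 𝔻`, `g = id`,
`Ψ = id` this uniformizes the disc with four marked circle points.) Ahlfors (1979), Ch. 6 §1.1;
Pommerenke (1992), Thm. 2.6. [folklore] -/
theorem isUniformizing_of_disc_extension (R : ConformalRectangle)
    (g : ConformalEquiv (ball (0 : ℂ) 1) R.carrier) {Ψ : ℂ → ℂ}
    (hΨc : ContinuousOn Ψ (closedBall 0 1)) (hΨg : EqOn Ψ g (ball 0 1)) {η : ℂ} (hη : ‖η‖ = 1)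
    {θ : Fin 4 → ℝ} (hθ : ∀ k, θ k ∈ Ioo 0 (2 * π)) (hmono : StrictMono θ ∨ StrictAnti θ)
    (hpt : ∀ k, Ψ (η * exp (θ k * I)) = R.pt k) :
    R.IsUniformizing (cayley.trans ((rotBall η hη).trans g))
      (fun k ↦ Real.tan (θ k / 2 - π / 2)) := by
  refine ⟨?_, fun k ↦ ?_⟩
  · rcases hmono with hm | hm
    · exact Or.inl fun i j hij ↦ strictMonoOn_tan_half (hθ i) (hθ j) (hm hij)
    · exact Or.inr fun i j hij ↦ strictMonoOn_tan_half (hθ j) (hθ i) (hm hij)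
  · have hmaps : MapsTo (fun w : ℂ ↦ η * w) (closedBall 0 1) (closedBall 0 1) := fun w hw ↦ by
      rw [mem_closedBall_zero_iff] at hw ⊢
      rwa [norm_mul, hη, one_mul]
    have hc : ContinuousOn (fun w ↦ Ψ (η * w)) (closedBall 0 1) :=
      hΨc.comp (by fun_prop) hmaps
    have heq : EqOn (fun w ↦ Ψ (η * w)) (cayley.symm.trans (cayley.trans ((rotBall η hη).trans g)))
        (ball 0 1) := by
      intro w hw
      have hw' : η * w ∈ ball (0 : ℂ) 1 := by
        rw [mem_ball_zero_iff] at hw ⊢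
        rwa [norm_mul, hη, one_mul]
      simp only [ConformalEquiv.trans_apply, rotBall_apply]
      rw [cayley.apply_symm_apply hw, hΨg hw']
    have h := JordanDomain.tendsto_nhdsWithin_of_extension (D := R.toJordanDomain)
      (cayley.trans ((rotBall η hη).trans g)) hc heq
      (x := ((Real.tan (θ k / 2 - π / 2) : ℝ) : ℂ)) (ofReal_im _).ge
    have hval : Ψ (η * cayleyFun (Real.tan (θ k / 2 - π / 2))) = R.pt k := by
      rw [cayleyFun_tan_half (hθ k), hpt k]
    rw [hval] at h
    exact h

end ConformalRectangle

/-! ### Cross-ratios of circle points -/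

/-- **The cross-ratio of the angular boundary parameters is the cross-ratio of the circle
points**: `crossRatio (tan (θ_k/2 - π/2))_k = cCrossRatio (e^{iθ_k})_k` (Möbius invariance of
the cross-ratio under the Cayley transform). Ahlfors (1979), Ch. 3 §3.1. [cite: AhlforsCA1979, Ch. 3 §3.1] -/
theorem crossRatio_tan_half {θ : Fin 4 → ℝ} (hθ : ∀ k, θ k ∈ Ioo 0 (2 * π)) :
    ((crossRatio fun k ↦ Real.tan (θ k / 2 - π / 2) : ℝ) : ℂ) =
      cCrossRatio fun k ↦ exp (θ k * I) := by
  rw [← cCrossRatio_ofReal]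
  have h := cCrossRatio_moebius (fun k ↦ ((Real.tan (θ k / 2 - π / 2) : ℝ) : ℂ)) (a := 1)
    (b := -I) (c := 1) (d := I) (by rw [one_mul, mul_one, sub_neg_eq_add, ← two_mul]; simp)
    (fun k ↦ by rw [one_mul]; exact add_I_ne_zero (ofReal_im _).ge)
  rw [← h]
  congr 1
  funext k
  simp only [one_mul]
  rw [← sub_eq_add_neg, ← cayleyFun_apply, cayleyFun_tan_half (hθ k)]

/-- The complex cross-ratio is invariant under `z ↦ η z`, `η ≠ 0`. [folklore] -/
theorem cCrossRatio_mul (z : Fin 4 → ℂ) {η : ℂ} (hη : η ≠ 0) :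
    cCrossRatio (fun k ↦ η * z k) = cCrossRatio z := by
  have h := cCrossRatio_moebius z (a := η) (b := 0) (c := 0) (d := 1) (by simpa using hη)
    (fun k ↦ by simp)
  simpa using h

/-- **Cross-ratio of a centrally symmetric quadruple of circle points**: for `‖v‖ = 1` and
`w ≠ 0`, `v ≠ 0`, the cross-ratio of `(w, vw, -w, -vw)` is `-(1 - v)²/(4v) = (1 - re v)/2`
(`= sin² (σ/2)` for `v = e^{iσ}`): it only depends on the angle between `w` and `vw`. Ahlfors
(1979), Ch. 3 §3.1. [folklore] -/
theorem cCrossRatio_symm {w v : ℂ} (hw : w ≠ 0) (hv : ‖v‖ = 1) :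
    cCrossRatio ![w, v * w, -w, -(v * w)] = (((1 - v.re) / 2 : ℝ) : ℂ) := by
  have hv0 : v ≠ 0 := norm_ne_zero_iff.1 (by rw [hv]; exact one_ne_zero)
  have hvc : v * conj v = 1 := by
    rw [mul_conj, Complex.normSq_eq_norm_sq, hv]; simp
  have hre : ((v.re : ℝ) : ℂ) = (v + conj v) / 2 := by
    rw [Complex.add_conj]; push_cast; ring
  unfold cCrossRatio
  simp only [Matrix.cons_val_zero, Matrix.cons_val_one, Matrix.cons_val]
  have hden : (w - -w) * (v * w - -(v * w)) ≠ 0 := by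
    have : (w - -w) * (v * w - -(v * w)) = 4 * v * w ^ 2 := by ring
    rw [this]
    exact mul_ne_zero (mul_ne_zero (by norm_num) hv0) (pow_ne_zero 2 hw)
  rw [div_eq_iff hden]
  push_cast
  rw [hre]
  linear_combination w ^ 2 * hvc

namespace ConformalRectangle

/-- **Uniformizing data with a centrally symmetric boundary quadruple.** Let `g : 𝔻 → D` be a
conformal equivalence with a continuous extension `Ψ` to the closed disc, and suppose the marked
points of the conformal rectangle `D` are `Ψ w, Ψ (vw), Ψ (-w), Ψ (-vw)` for unit complex numbers
`w, v` with `v ∉ ℝ`. Then `D` has a uniformizing datum of cross-ratio `(1 - re v)/2`: the angles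
of `(w, vw, -w, -vw)` from a suitable base point are increasing when `im v > 0` and decreasing
when `im v < 0` (`isUniformizing_of_disc_extension`, `crossRatio_tan_half`, `cCrossRatio_symm`).
Ahlfors (1979), Ch. 3 §3.1 and Ch. 6 §1.1. [folklore] -/
theorem exists_isUniformizing_of_symm (R : ConformalRectangle)
    (g : ConformalEquiv (ball (0 : ℂ) 1) R.carrier) {Ψ : ℂ → ℂ}
    (hΨc : ContinuousOn Ψ (closedBall 0 1)) (hΨg : EqOn Ψ g (ball 0 1)) {w v : ℂ} (hw : ‖w‖ = 1)
    (hv : ‖v‖ = 1) (hvi : v.im ≠ 0) (h0 : Ψ w = R.pt 0) (h1 : Ψ (v * w) = R.pt 1)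
    (h2 : Ψ (-w) = R.pt 2) (h3 : Ψ (-(v * w)) = R.pt 3) :
    ∃ (φ : ConformalEquiv upperHalfPlaneSet R.carrier) (x : Fin 4 → ℝ),
      R.IsUniformizing φ x ∧ crossRatio x = (1 - v.re) / 2 := by
  -- polar forms
  set σ : ℝ := arg v with hσ
  set α : ℝ := arg w with hα
  have hvexp : v = exp (σ * I) := by
    have := norm_mul_exp_arg_mul_I v
    rw [hv, ofReal_one, one_mul] at this
    exact this.symm
  have hwexp : w = exp (α * I) := by
    have := norm_mul_exp_arg_mul_I w
    rw [hw, ofReal_one, one_mul] at this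
    exact this.symm
  have hw0 : w ≠ 0 := norm_ne_zero_iff.1 (by rw [hw]; exact one_ne_zero)
  have hsinσ : Real.sin σ = v.im := by
    conv_rhs => rw [hvexp]
    rw [exp_ofReal_mul_I_im]
  have hσ_lt : σ ≤ π := arg_le_pi v
  have hσ_gt : -π < σ := neg_pi_lt_arg v
  -- the common conclusion from angles `θ` with `η e^{iθ_k}` the four points
  have main : ∀ (θ : Fin 4 → ℝ), (∀ k, θ k ∈ Ioo 0 (2 * π)) → (StrictMono θ ∨ StrictAnti θ) →
      (∀ k, exp ((α - θ 0) * I) * exp (θ k * I) = ![w, v * w, -w, -(v * w)] k) →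
      ∃ (φ : ConformalEquiv upperHalfPlaneSet R.carrier) (x : Fin 4 → ℝ),
        R.IsUniformizing φ x ∧ crossRatio x = (1 - v.re) / 2 := by
    intro θ hθ hmono hk
    have hη : ‖exp ((α - θ 0) * I)‖ = 1 := by
      have e : ((α - θ 0 : ℝ) : ℂ) = (α : ℂ) - (θ 0 : ℂ) := by push_cast; ring
      rw [← e]
      exact norm_exp_ofReal_mul_I (α - θ 0)
    have hpt : ∀ k, Ψ (exp ((α - θ 0) * I) * exp (θ k * I)) = R.pt k := by
      intro k
      rw [hk k]
      fin_cases k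
      · exact h0
      · exact h1
      · exact h2
      · exact h3
    refine ⟨_, _, R.isUniformizing_of_disc_extension g hΨc hΨg hη hθ hmono hpt, ?_⟩
    apply Complex.ofReal_injective
    rw [crossRatio_tan_half hθ, ← cCrossRatio_mul _ (Complex.exp_ne_zero ((α - θ 0) * I)),
      show (fun k ↦ exp ((α - θ 0) * I) * exp (θ k * I)) = ![w, v * w, -w, -(v * w)] from funext hk,
      cCrossRatio_symm hw0 hv]
  -- the four identities `e^{i(α-θ₀)} e^{iθ_k} = …` in terms of the angle differences
  have hk_of : ∀ (θ : Fin 4 → ℝ), θ 1 - θ 0 = σ → (θ 2 - θ 0 = π ∨ θ 2 - θ 0 = -π) →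
      (θ 3 - θ 0 = σ + π ∨ θ 3 - θ 0 = σ - π) →
      ∀ k, exp ((α - θ 0) * I) * exp (θ k * I) = ![w, v * w, -w, -(v * w)] k := by
    intro θ e1 e2 e3
    have hpi : exp (π * I) = -1 := exp_pi_mul_I
    have hsplit : ∀ k, exp ((α - θ 0) * I) * exp (θ k * I) = w * exp (((θ k - θ 0 : ℝ) : ℂ) * I) := by
      intro k
      rw [hwexp, ← Complex.exp_add, ← Complex.exp_add]
      congr 1
      push_cast
      ring
    intro k
    rw [hsplit k]
    fin_cases k
    · simp
    · simp only [Fin.mk_one, Matrix.cons_val_one, Matrix.cons_val_zero]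
      rw [e1, ← hvexp, mul_comm]
    · simp only [Fin.reduceFinMk, Matrix.cons_val]
      rcases e2 with e | e
      · rw [e, hpi]; ring
      · rw [e, ofReal_neg, neg_mul, Complex.exp_neg, hpi]; ring
    · simp only [Fin.reduceFinMk, Matrix.cons_val]
      rcases e3 with e | e
      · rw [e, ofReal_add, add_mul, Complex.exp_add, hpi, ← hvexp]; ring
      · rw [e, ofReal_sub, sub_mul, Complex.exp_sub, hpi, ← hvexp]; ring
  rcases lt_or_gt_of_ne hvi with hneg | hpos
  · -- `im v < 0`: `σ ∈ (-π, 0)`, decreasing angles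
    have hσ0 : σ < 0 := by
      by_contra h
      push Not at h
      have := Real.sin_nonneg_of_nonneg_of_le_pi h hσ_lt
      linarith
    refine main ![3 * π / 2 - σ / 2, 3 * π / 2 + σ / 2, π / 2 - σ / 2, π / 2 + σ / 2] ?_ ?_
      (hk_of _ ?_ ?_ ?_)
    · intro k
      fin_cases k <;> simp only [Fin.reduceFinMk, Fin.mk_one, Fin.zero_eta, Matrix.cons_val,
        Matrix.cons_val_one, Matrix.cons_val_zero, mem_Ioo] <;> constructor <;> linarith [pi_pos]
    · right
      refine Fin.strictAnti_iff_succ_lt.2 fun k ↦ ?_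
      fin_cases k <;> simp <;> linarith [pi_pos]
    · simp
    · right; simp; ring
    · right; simp; ring
  · -- `0 < im v`: `σ ∈ (0, π)`, increasing angles
    have hσ0 : 0 < σ := by
      by_contra h
      push Not at h
      have := Real.sin_nonpos_of_nonpos_of_neg_pi_le h hσ_gt.le
      linarith
    have hσπ : σ < π := by
      rcases hσ_lt.lt_or_eq with h | h
      · exact h
      · exfalso; rw [h, Real.sin_pi] at hsinσ; exact hvi hsinσ.symm
    refine main ![π / 2 - σ / 2, π / 2 + σ / 2, 3 * π / 2 - σ / 2, 3 * π / 2 + σ / 2] ?_ ?_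
      (hk_of _ ?_ ?_ ?_)
    · intro k
      fin_cases k <;> simp only [Fin.reduceFinMk, Fin.mk_one, Fin.zero_eta, Matrix.cons_val,
        Matrix.cons_val_one, Matrix.cons_val_zero, mem_Ioo] <;> constructor <;> linarith [pi_pos]
    · left
      refine Fin.strictMono_iff_lt_succ.2 fun k ↦ ?_
      fin_cases k <;> simp <;> linarith [pi_pos]
    · simp
    · left; simp; ring
    · left; simp; ring

end ConformalRectangle

end Literature.Probability.RandomPlanarGeometry
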